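import Mathlib
import HarnessLib
import Literature.MathematicalPhysics.StatisticalMechanics.LennardJonesClusters

/-!
# Window averaging for Lennard-Jones ground states: a far-field WINDOW LAW prices its species GLOBALLY
# (route ContactSaturationLadder, item E₂ = `TwelveGapTextureRung` stmt-AtomisticToContinuum-31516 — registered stub `stub_windowToSlack` of its
# line «ElasticWindow», PROVED; decomposition cell decomp-a2c, lens-1 «grading / quantitative ladder», g8)

Definition-free and GENERIC in: a reference energy `e : ℝ`, a priced species `B` and an allowance species `A` (selectors
`(N : ℕ) → (Fin N → ℝ³) → Finset (Fin N)`), a price `c : ℝ`.  This is the shared «window currency» of the cell's lenses 1/3/5 (writer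
concordance #3 «BarlowChartRigidity»; lens-5's `HaloRatioDial.averagingBridge_holds` is the `A = ∅` ancestor, credited):

* WINDOW LAW (hypothesis of `stub_windowToSlack`): for every `ε > 0` and all radii `ρ ≥ ρ₀(ε)`, every window `B(p,ρ)` of every finite LJ
  ground state whose doubled window `B(p,2ρ)` holds NO allowance particle satisfies
  `c·#(B ∩ B(p,ρ)) − ε·#B(p,2ρ) ≤ Σ_{y_i ∈ B(p,ρ)} (𝓔ⁱ/2 − e)`.
* §3 NEAR-FIELD FLOOR `nearField_floor` (PROVED, pure bookkeeping): windows that DO see an allowance particle satisfy the same inequality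
  with an allowance debit `C₁·#(A ∩ B(p,2ρ))` and no `ε` — uniform minimal distance of LJ ground states (`LennardJonesMinimalDistance_holds`),
  the shell sum `Σ|y_i−y_k|⁻⁶ ≤ 250δ⁻⁶` (`sum_inv_pow_six_le`), packing (`card_le_of_separated_of_dist_le`).  Hence the UNRESTRICTED local
  law `localLaw_of_windowLaw`.
* §4 AVERAGING `slackLaw_of_localLaw` (PROVED, pure measure theory): integrate the local law over the centre `p ∈ ℝ³`; counts over `B(p,r)`
  integrate to `count · r³|B(0,1)|`, and `Σ_i 𝓔ⁱ/2 = E`.  Result, the SLACK LAW: `∀ ε>0 ∃ C₁ ∀ N y GS, c·#B − C₁·#A ≤ E(y) − N·e + ε·N`.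
* §5 `stub_windowToSlack` = the registered stub, by name and signature.

No facts, no conjectures; axioms `propext, Classical.choice, Quot.sound`.
-/

namespace Summit.AtomisticToContinuum.Crystallization.Theorems.ContactSaturationLadderWindowAveraging

open scoped BigOperators Topology Classical
open Filter MeasureTheory Metric
open Literature.MathematicalPhysics.StatisticalMechanics (lennardJones IsGroundState interactionEnergy
  PeriodicConfiguration siteEnergy two_mul_interactionEnergy LennardJonesMinimalDistance_holds
  sum_inv_pow_six_le neg_le_lennardJones_of_le card_le_of_separated_of_dist_le)

/-! ## §3 The near-field floor (PROVED): windows that see an allowance particle cost at most a constant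

Ingredients, all in the tree: the uniform minimal distance of LJ ground states (`LennardJonesMinimalDistance_holds`, Xue / Blanc),
the shell sum `Σ_{k≠i} |y_i − y_k|⁻⁶ ≤ 250 δ⁻⁶` (`sum_inv_pow_six_le`) and the packing bound (`card_le_of_separated_of_dist_le`). -/

/-- Site energies of a `δ`-separated configuration are bounded below: `𝓔ⁱ ≥ −(250/6)·δ⁻⁶`. -/
theorem siteEnergy_ge_of_sep {N : ℕ} (y : Fin N → EuclideanSpace ℝ (Fin 3)) {δ : ℝ} (hδ : 0 < δ)
    (hsep : ∀ k l : Fin N, k ≠ l → δ ≤ dist (y k) (y l)) (i : Fin N) :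
    -(250 / 6 * δ⁻¹ ^ 6) ≤ siteEnergy lennardJones y i := by
  unfold siteEnergy
  have hterm : ∀ k ∈ Finset.univ.erase i, -((1 / 6) * (dist (y i) (y k))⁻¹ ^ 6) ≤ lennardJones (dist (y i) (y k)) := by
    intro k hk
    have hne : i ≠ k := (Finset.ne_of_mem_erase hk).symm
    have hpos : 0 < dist (y i) (y k) := lt_of_lt_of_le hδ (hsep i k hne)
    exact neg_le_lennardJones_of_le hpos le_rfl
  have hsum := Finset.sum_le_sum hterm
  have hshell := sum_inv_pow_six_le y hδ hsep i
  have hrw : ∑ k ∈ Finset.univ.erase i, -((1 / 6) * (dist (y i) (y k))⁻¹ ^ 6) =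
      -((1 / 6) * ∑ k ∈ Finset.univ.erase i, (dist (y i) (y k))⁻¹ ^ 6) := by
    rw [Finset.mul_sum, ← Finset.sum_neg_distrib]
  rw [hrw] at hsum
  linarith

/-- The number of particles of an injective `δ`-separated configuration in a ball of radius `R ≥ 0` is at most `(2R/δ+1)³`. -/
theorem card_window_le {N : ℕ} {y : Fin N → EuclideanSpace ℝ (Fin 3)} (hy : Function.Injective y) {δ : ℝ} (hδ : 0 < δ)
    (hsep : ∀ k l : Fin N, k ≠ l → δ ≤ dist (y k) (y l)) (p : EuclideanSpace ℝ (Fin 3)) {R : ℝ} (hR : 0 ≤ R) :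
    ((Finset.univ.filter fun i : Fin N => dist (y i) p ≤ R).card : ℝ) ≤ (2 * R / δ + 1) ^ 3 := by
  set W := Finset.univ.filter fun i : Fin N => dist (y i) p ≤ R with hW
  have hc : (W.image y).card = W.card := Finset.card_image_of_injective _ hy
  have h := card_le_of_separated_of_dist_le (W.image y) p hδ hR ?_ ?_
  · rw [hc, finrank_euclideanSpace_fin] at h
    exact h
  · intro c hc'
    obtain ⟨i, hi, rfl⟩ := Finset.mem_image.1 hc'
    exact (Finset.mem_filter.1 hi).2
  · intro c hc' d hd hne
    obtain ⟨i, hi, rfl⟩ := Finset.mem_image.1 hc'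
    obtain ⟨j, hj, rfl⟩ := Finset.mem_image.1 hd
    exact hsep i j fun h => hne (h ▸ rfl)

/-- **Near-field floor.**  For every price `c`, radius `ρ > 0` there is an allowance rate `C₁ ≥ 0` such that every window of every LJ
ground state that sees an allowance particle in its doubled window satisfies the local inequality with NO `ε` (pure bookkeeping:
the window holds at most `(2ρ/δ+1)³` particles, each with `𝓔ⁱ/2 − e⋆ ≥ −(125/6)δ⁻⁶ − |e⋆|`). -/
theorem nearField_floor (e : ℝ) (B A : ((N : ℕ) → (Fin N → EuclideanSpace ℝ (Fin 3)) → Finset (Fin N))) (c : ℝ) {ρ : ℝ} (hρ : 0 < ρ) :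
    ∃ C₁ : ℝ, 0 ≤ C₁ ∧ ∀ (N : ℕ) (y : Fin N → EuclideanSpace ℝ (Fin 3)), IsGroundState lennardJones y →
      ∀ p : EuclideanSpace ℝ (Fin 3), (∃ i : Fin N, dist (y i) p ≤ 2 * ρ ∧ i ∈ A N y) →
        c * (((B N y).filter fun i : Fin N => dist (y i) p ≤ ρ).card : ℝ)
            - C₁ * (((A N y).filter fun i : Fin N => dist (y i) p ≤ 2 * ρ).card : ℝ)
          ≤ ∑ i ∈ Finset.univ.filter (fun i : Fin N => dist (y i) p ≤ ρ), (siteEnergy lennardJones y i / 2 - e) := by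
  obtain ⟨δ, hδ, hsep⟩ := LennardJonesMinimalDistance_holds
  set M : ℝ := (2 * ρ / δ + 1) ^ 3 with hM
  set S : ℝ := 125 / 6 * δ⁻¹ ^ 6 + |e| with hS
  have hMpos : 0 ≤ M := by positivity
  have hSpos : 0 ≤ S := by positivity
  refine ⟨(|c| + S) * M, by positivity, fun N y hy p hA => ?_⟩
  have hsepy : ∀ k l : Fin N, k ≠ l → δ ≤ dist (y k) (y l) := hsep N y hy
  set W := Finset.univ.filter (fun i : Fin N => dist (y i) p ≤ ρ) with hW
  -- (1) the window is small
  have hWcard : (W.card : ℝ) ≤ M := card_window_le hy.1 hδ hsepy p hρ.le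
  -- (2) the priced count is at most the window count
  have hBle : (((B N y).filter fun i : Fin N => dist (y i) p ≤ ρ).card : ℝ) ≤ W.card := by
    exact_mod_cast Finset.card_le_card (fun i hi => Finset.mem_filter.2 ⟨Finset.mem_univ _, (Finset.mem_filter.1 hi).2⟩)
  -- (3) at least one allowance particle in the doubled window
  have hAge : (1 : ℝ) ≤ (((A N y).filter fun i : Fin N => dist (y i) p ≤ 2 * ρ).card : ℝ) := by
    obtain ⟨i, hi, hiA⟩ := hA
    have : 1 ≤ ((A N y).filter fun i : Fin N => dist (y i) p ≤ 2 * ρ).card :=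
      Finset.card_pos.2 ⟨i, Finset.mem_filter.2 ⟨hiA, hi⟩⟩
    exact_mod_cast this
  -- (4) the site floor on the window
  have hsite : ∀ i ∈ W, -S ≤ siteEnergy lennardJones y i / 2 - e := by
    intro i _
    have h1 := siteEnergy_ge_of_sep y hδ hsepy i
    have h2 : -|e| ≤ -e := by linarith [le_abs_self e]
    rw [hS]
    linarith
  have hsum : -S * W.card ≤ ∑ i ∈ W, (siteEnergy lennardJones y i / 2 - e) := by
    have := Finset.card_nsmul_le_sum W (fun i => siteEnergy lennardJones y i / 2 - e) (-S) hsite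
    rw [nsmul_eq_mul] at this
    linarith
  -- assemble
  have hc1 : c * (((B N y).filter fun i : Fin N => dist (y i) p ≤ ρ).card : ℝ) ≤ |c| * M := by
    have := le_abs_self c
    have hBM : (((B N y).filter fun i : Fin N => dist (y i) p ≤ ρ).card : ℝ) ≤ M := hBle.trans hWcard
    nlinarith [abs_nonneg c, Nat.cast_nonneg (α := ℝ) (((B N y).filter fun i : Fin N => dist (y i) p ≤ ρ).card)]
  have hc2 : (|c| + S) * M ≤ (|c| + S) * M * (((A N y).filter fun i : Fin N => dist (y i) p ≤ 2 * ρ).card : ℝ) := by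
    have h0 : 0 ≤ (|c| + S) * M := by positivity
    nlinarith
  nlinarith [hsum, hWcard, hc1, hc2, hSpos, hMpos]

/-- **Far field + near-field floor ⇒ the unrestricted local law** (case split on an allowance particle in the doubled window). -/
theorem localLaw_of_windowLaw {e : ℝ} {B A : ((N : ℕ) → (Fin N → EuclideanSpace ℝ (Fin 3)) → Finset (Fin N))} {c : ℝ}
    (h : (∀ ε : ℝ, 0 < ε → ∃ ρ₀ : ℝ, 0 < ρ₀ ∧ ∀ ρ : ℝ, ρ₀ ≤ ρ → ∀ (N : ℕ) (y : Fin N → EuclideanSpace ℝ (Fin 3)), IsGroundState lennardJones y → ∀ p : EuclideanSpace ℝ (Fin 3), (∀ i : Fin N, dist (y i) p ≤ 2 * ρ → i ∉ A N y) → c * (((B N y).filter fun i : Fin N => dist (y i) p ≤ ρ).card : ℝ) - ε * ((Finset.univ.filter fun i : Fin N => dist (y i) p ≤ 2 * ρ).card : ℝ) ≤ ∑ i ∈ Finset.univ.filter (fun i : Fin N => dist (y i) p ≤ ρ), (siteEnergy lennardJones y i / 2 - e))) :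
    (∀ ε : ℝ, 0 < ε → ∃ ρ : ℝ, 0 < ρ ∧ ∃ C₁ : ℝ, ∀ (N : ℕ) (y : Fin N → EuclideanSpace ℝ (Fin 3)), IsGroundState lennardJones y → ∀ p : EuclideanSpace ℝ (Fin 3), c * (((B N y).filter fun i : Fin N => dist (y i) p ≤ ρ).card : ℝ) - C₁ * (((A N y).filter fun i : Fin N => dist (y i) p ≤ 2 * ρ).card : ℝ) - ε * ((Finset.univ.filter fun i : Fin N => dist (y i) p ≤ 2 * ρ).card : ℝ) ≤ ∑ i ∈ Finset.univ.filter (fun i : Fin N => dist (y i) p ≤ ρ), (siteEnergy lennardJones y i / 2 - e)) := by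
  intro ε hε
  obtain ⟨ρ₀, hρ₀, hfar⟩ := h ε hε
  obtain ⟨C₁, hC₁, hnear⟩ := nearField_floor e B A c hρ₀
  refine ⟨ρ₀, hρ₀, C₁, fun N y hy p => ?_⟩
  by_cases hA : ∃ i : Fin N, dist (y i) p ≤ 2 * ρ₀ ∧ i ∈ A N y
  · have h1 := hnear N y hy p hA
    have h2 : 0 ≤ ε * ((Finset.univ.filter fun i : Fin N => dist (y i) p ≤ 2 * ρ₀).card : ℝ) := by positivity
    linarith
  · push Not at hA
    have h1 := hfar ρ₀ le_rfl N y hy p (fun i hi hiA => hA i hi hiA)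
    have hz : (((A N y).filter fun i : Fin N => dist (y i) p ≤ 2 * ρ₀).card : ℝ) = 0 := by
      rw [Nat.cast_eq_zero, Finset.card_eq_zero, Finset.filter_eq_empty_iff]
      exact fun i hiA hi => hA i hi hiA
    rw [hz, mul_zero, sub_zero]
    exact h1


/-! ## §4 The averaging bridge (PROVED): the unrestricted local law ⇒ the global slack law

Adapted, with credit, from decomp-a2c-lens-5 g7 `HaloRatioDial.averagingBridge_holds` (pure measure theory, no physics), made GENERIC in
the two selectors: integrate the local inequality over the centre `p ∈ ℝ³` against Lebesgue measure; a count over `B(p,r)` integrates to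
`(count) · r³|B(0,1)|`, the doubled-window terms to `8ρ³|B(0,1)| · (count)`, and `Σ_i 𝓔ⁱ/2 = E`. -/

section Averaging

/-- Lebesgue volume of a closed ball of radius `r ≥ 0` in `ℝ³`: `r³ · |B(0,1)|`. -/
theorem volReal_closedBall (p : EuclideanSpace ℝ (Fin 3)) {r : ℝ} (hr : 0 ≤ r) :
    (volume : Measure (EuclideanSpace ℝ (Fin 3))).real (closedBall p r)
      = r ^ 3 * (volume : Measure (EuclideanSpace ℝ (Fin 3))).real (ball 0 1) := by
  rw [Measure.addHaar_real_closedBall volume p hr, finrank_euclideanSpace_fin]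

/-- A finite sum of constants times indicators of closed balls is integrable. -/
theorem integrable_sum_indicator_closedBall {N : ℕ} (y : Fin N → EuclideanSpace ℝ (Fin 3)) (g : Fin N → ℝ) (r : ℝ) :
    Integrable (fun p : EuclideanSpace ℝ (Fin 3) => ∑ i, (closedBall (y i) r).indicator (fun _ => g i) p) :=
  integrable_finsetSum _ fun i _ =>
    (integrableOn_const (measure_closedBall_lt_top (μ := volume)).ne).integrable_indicator measurableSet_closedBall

/-- `∫_{ℝ³} Σ_i g_i 1_{B(y_i,r)}(p) dp = (Σ_i g_i) · r³ |B(0,1)|`. -/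
theorem integral_sum_indicator_closedBall {N : ℕ} (y : Fin N → EuclideanSpace ℝ (Fin 3)) (g : Fin N → ℝ) {r : ℝ}
    (hr : 0 ≤ r) :
    ∫ p, (∑ i, (closedBall (y i) r).indicator (fun _ => g i) p)
      = (∑ i, g i) * (r ^ 3 * (volume : Measure (EuclideanSpace ℝ (Fin 3))).real (ball 0 1)) := by
  rw [integral_finsetSum _ fun i _ =>
    (integrableOn_const (measure_closedBall_lt_top (μ := volume)).ne).integrable_indicator measurableSet_closedBall]
  rw [Finset.sum_mul]
  refine Finset.sum_congr rfl fun i _ => ?_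
  rw [integral_indicator_const (g i) measurableSet_closedBall, volReal_closedBall (y i) hr, smul_eq_mul, mul_comm]

/-- A window count restricted to a sub-finset `S`, as a sum of ball indicators evaluated at the centre. -/
theorem card_filter_mem_eq_sum {N : ℕ} (S : Finset (Fin N)) (y : Fin N → EuclideanSpace ℝ (Fin 3)) (r : ℝ)
    (p : EuclideanSpace ℝ (Fin 3)) :
    ((S.filter fun i : Fin N => dist (y i) p ≤ r).card : ℝ)
      = ∑ i, (closedBall (y i) r).indicator (fun _ => if i ∈ S then (1 : ℝ) else 0) p := by
  have hS : (S.filter fun i : Fin N => dist (y i) p ≤ r) = Finset.univ.filter (fun i : Fin N => i ∈ S ∧ dist (y i) p ≤ r) := by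
    ext i
    simp [Finset.mem_filter]
  rw [hS, Finset.natCast_card_filter]
  refine Finset.sum_congr rfl fun i _ => ?_
  by_cases hd : dist (y i) p ≤ r
  · rw [Set.indicator_of_mem (mem_closedBall'.2 hd)]
    by_cases hm : i ∈ S <;> simp [hm, hd]
  · rw [Set.indicator_of_notMem (fun h => hd (mem_closedBall'.1 h))]
    simp [hd]

/-- The number of particles in the window `B(p,r)` as a sum of ball indicators evaluated at the centre `p`. -/
theorem card_filter_eq_sum {N : ℕ} (y : Fin N → EuclideanSpace ℝ (Fin 3)) (r : ℝ) (p : EuclideanSpace ℝ (Fin 3)) :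
    ((Finset.univ.filter fun i : Fin N => dist (y i) p ≤ r).card : ℝ)
      = ∑ i, (closedBall (y i) r).indicator (fun _ => (1 : ℝ)) p := by
  rw [Finset.natCast_card_filter]
  refine Finset.sum_congr rfl fun i _ => ?_
  by_cases hd : dist (y i) p ≤ r
  · rw [Set.indicator_of_mem (mem_closedBall'.2 hd)]
    simp [hd]
  · rw [Set.indicator_of_notMem (fun h => hd (mem_closedBall'.1 h))]
    simp [hd]

/-- A sum over the particles of the window `B(p,r)` as a sum of ball indicators evaluated at the centre `p`. -/
theorem sum_filter_eq_sum_indicator {N : ℕ} (y : Fin N → EuclideanSpace ℝ (Fin 3)) (g : Fin N → ℝ) (r : ℝ)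
    (p : EuclideanSpace ℝ (Fin 3)) :
    ∑ i ∈ Finset.univ.filter (fun i : Fin N => dist (y i) p ≤ r), g i
      = ∑ i, (closedBall (y i) r).indicator (fun _ => g i) p := by
  rw [Finset.sum_filter]
  refine Finset.sum_congr rfl fun i _ => ?_
  by_cases hd : dist (y i) p ≤ r
  · rw [Set.indicator_of_mem (mem_closedBall'.2 hd)]
    simp [hd]
  · rw [Set.indicator_of_notMem (fun h => hd (mem_closedBall'.1 h))]
    simp [hd]

/-- `Σ_i (𝓔ⁱ/2 − e⋆) = E − N e⋆`. -/
theorem sum_half_siteEnergy_sub (e : ℝ) {N : ℕ} (y : Fin N → EuclideanSpace ℝ (Fin 3)) :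
    ∑ i, (siteEnergy lennardJones y i / 2 - e) = interactionEnergy lennardJones y - N * e := by
  rw [Finset.sum_sub_distrib, ← Finset.sum_div, ← two_mul_interactionEnergy, Finset.sum_const, Finset.card_univ,
    Fintype.card_fin, nsmul_eq_mul]
  ring

/-- `Σ_i [i ∈ S] = #S`. -/
theorem sum_ite_mem_one {N : ℕ} (S : Finset (Fin N)) : ∑ i : Fin N, (if i ∈ S then (1 : ℝ) else 0) = S.card := by
  rw [Finset.sum_ite_mem, Finset.univ_inter, Finset.sum_const, nsmul_eq_mul, mul_one]

/-- **THE BRIDGE (proved, generic).**  `LocalLaw B A c → SlackLaw B A c` (allowance rate multiplied by 8). -/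
theorem slackLaw_of_localLaw {e : ℝ} {B A : ((N : ℕ) → (Fin N → EuclideanSpace ℝ (Fin 3)) → Finset (Fin N))} {c : ℝ}
    (hloc : (∀ ε : ℝ, 0 < ε → ∃ ρ : ℝ, 0 < ρ ∧ ∃ C₁ : ℝ, ∀ (N : ℕ) (y : Fin N → EuclideanSpace ℝ (Fin 3)), IsGroundState lennardJones y → ∀ p : EuclideanSpace ℝ (Fin 3), c * (((B N y).filter fun i : Fin N => dist (y i) p ≤ ρ).card : ℝ) - C₁ * (((A N y).filter fun i : Fin N => dist (y i) p ≤ 2 * ρ).card : ℝ) - ε * ((Finset.univ.filter fun i : Fin N => dist (y i) p ≤ 2 * ρ).card : ℝ) ≤ ∑ i ∈ Finset.univ.filter (fun i : Fin N => dist (y i) p ≤ ρ), (siteEnergy lennardJones y i / 2 - e))) :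
    (∀ ε : ℝ, 0 < ε → ∃ C₁ : ℝ, ∀ (N : ℕ) (y : Fin N → EuclideanSpace ℝ (Fin 3)), IsGroundState lennardJones y → c * ((B N y).card : ℝ) - C₁ * ((A N y).card : ℝ) ≤ interactionEnergy lennardJones y - N * e + ε * N) := by
  intro ε hε
  obtain ⟨ρ, hρ, C₁, hwin⟩ := hloc (ε / 8) (by positivity)
  refine ⟨8 * C₁, fun N y hy => ?_⟩
  set v1 : ℝ := (volume : Measure (EuclideanSpace ℝ (Fin 3))).real (ball 0 1) with hv1
  have hv1pos : 0 < v1 :=   -- (= `Literature.Analysis.FluidPDE.TaoY6.volumeReal_unitBall_pos`, inlined to keep the import list physical)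
    ENNReal.toReal_pos (measure_ball_pos volume _ one_pos).ne' measure_ball_lt_top.ne
  set L : EuclideanSpace ℝ (Fin 3) → ℝ := fun p =>
    c * ∑ i, (closedBall (y i) ρ).indicator (fun _ => if i ∈ B N y then (1 : ℝ) else 0) p
      - C₁ * ∑ i, (closedBall (y i) (2 * ρ)).indicator (fun _ => if i ∈ A N y then (1 : ℝ) else 0) p
      - ε / 8 * ∑ i, (closedBall (y i) (2 * ρ)).indicator (fun _ => (1 : ℝ)) p with hL
  set R : EuclideanSpace ℝ (Fin 3) → ℝ := fun p =>
    ∑ i, (closedBall (y i) ρ).indicator (fun _ => siteEnergy lennardJones y i / 2 - e) p with hR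
  have hLR : L ≤ R := by
    intro p
    have h := hwin N y hy p
    rw [card_filter_mem_eq_sum, card_filter_mem_eq_sum, card_filter_eq_sum, sum_filter_eq_sum_indicator] at h
    exact h
  have hLi : Integrable L :=
    (((integrable_sum_indicator_closedBall y _ ρ).const_mul c).sub
      ((integrable_sum_indicator_closedBall y _ (2 * ρ)).const_mul C₁)).sub
      ((integrable_sum_indicator_closedBall y _ (2 * ρ)).const_mul (ε / 8))
  have hRi : Integrable R := integrable_sum_indicator_closedBall y _ ρ
  have hint := integral_mono hLi hRi hLR
  have hN : ∑ _i : Fin N, (1 : ℝ) = N := by simp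
  have hL' : ∫ p, L p = (c * ((B N y).card : ℝ) - 8 * C₁ * ((A N y).card : ℝ) - ε * N) * (ρ ^ 3 * v1) := by
    rw [hL]
    rw [integral_sub, integral_sub, integral_const_mul, integral_const_mul, integral_const_mul,
      integral_sum_indicator_closedBall y _ hρ.le,
      integral_sum_indicator_closedBall y _ (by positivity : (0 : ℝ) ≤ 2 * ρ),
      integral_sum_indicator_closedBall y _ (by positivity : (0 : ℝ) ≤ 2 * ρ), sum_ite_mem_one, sum_ite_mem_one, hN]
    · ring
    · exact (integrable_sum_indicator_closedBall y _ ρ).const_mul c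
    · exact (integrable_sum_indicator_closedBall y _ (2 * ρ)).const_mul C₁
    · exact ((integrable_sum_indicator_closedBall y _ ρ).const_mul c).sub
        ((integrable_sum_indicator_closedBall y _ (2 * ρ)).const_mul C₁)
    · exact (integrable_sum_indicator_closedBall y _ (2 * ρ)).const_mul (ε / 8)
  have hR' : ∫ p, R p = (interactionEnergy lennardJones y - N * e) * (ρ ^ 3 * v1) := by
    rw [hR, integral_sum_indicator_closedBall y _ hρ.le, sum_half_siteEnergy_sub]
  rw [hL', hR'] at hint
  have hpos : 0 < ρ ^ 3 * v1 := by positivity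
  have := le_of_mul_le_mul_right hint hpos
  linarith

end Averaging

/-! ## §5 The registered stub of E₂'s line, BY NAME -/

/-- **REGISTERED STUB `stub_windowToSlack`** of the line «ElasticWindow» on `ContactSaturationLadder.TwelveGapTextureRung` (item
stmt-AtomisticToContinuum-31516, skeleton v3 `TwelveGapTextureRung_line_v3.lean`): a far-field WINDOW LAW for a species `B` with allowance
`A` at price `c` (relative to ANY reference energy `e`; the line instantiates `e := inf over periodic configurations of the energy per
particle`) prices the species GLOBALLY with `o(N)` slack.  = `slackLaw_of_localLaw ∘ localLaw_of_windowLaw`. -/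
theorem stub_windowToSlack : ∀ (e : ℝ) (B A : ((N : ℕ) → (Fin N → EuclideanSpace ℝ (Fin 3)) → Finset (Fin N))) (c : ℝ), (∀ ε : ℝ, 0 < ε → ∃ ρ₀ : ℝ, 0 < ρ₀ ∧ ∀ ρ : ℝ, ρ₀ ≤ ρ → ∀ (N : ℕ) (y : Fin N → EuclideanSpace ℝ (Fin 3)), Literature.MathematicalPhysics.StatisticalMechanics.IsGroundState Literature.MathematicalPhysics.StatisticalMechanics.lennardJones y → ∀ p : EuclideanSpace ℝ (Fin 3), (∀ i : Fin N, dist (y i) p ≤ 2 * ρ → i ∉ A N y) → c * (((B N y).filter fun i : Fin N => dist (y i) p ≤ ρ).card : ℝ) - ε * ((Finset.univ.filter fun i : Fin N => dist (y i) p ≤ 2 * ρ).card : ℝ) ≤ ∑ i ∈ Finset.univ.filter (fun i : Fin N => dist (y i) p ≤ ρ), (Literature.MathematicalPhysics.StatisticalMechanics.siteEnergy Literature.MathematicalPhysics.StatisticalMechanics.lennardJones y i / 2 - e)) → (∀ ε : ℝ, 0 < ε → ∃ C₁ : ℝ, ∀ (N : ℕ) (y : Fin N → EuclideanSpace ℝ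 (Fin 3)), Literature.MathematicalPhysics.StatisticalMechanics.IsGroundState Literature.MathematicalPhysics.StatisticalMechanics.lennardJones y → c * ((B N y).card : ℝ) - C₁ * ((A N y).card : ℝ) ≤ Literature.MathematicalPhysics.StatisticalMechanics.interactionEnergy Literature.MathematicalPhysics.StatisticalMechanics.lennardJones y - N * e + ε * N) :=
  fun _ _ _ _ h => slackLaw_of_localLaw (localLaw_of_windowLaw h)

end Summit.AtomisticToContinuum.Crystallization.Theorems.ContactSaturationLadderWindowAveraging
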